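import Summits.Ventures.PercRepro.RankLevelSetRuleQCellThree
import Summits.Ventures.PercRepro.RankLevelSetRuleQCellFour

/-!
# PercRepro — (R̂), RULE Q AND THE UP-HALL FORM OF C-044 ON EVERY CELL `(q+k, q)` WITH `k ≤ 4`; the slice sums below `R̂` for EVERY `k`
(p4, gen 21; paper proofs/P4-CELL-THREE.md)

* **`rhatCell_of_le_four`** / **`ruleQUp_of_le_four`** / **`hallUp_of_le_four`** — the cell families `k = 2, 3, 4`
  (RankLevelSetRuleQCellTwo / Three / Four) in one statement: for every `q ≥ 1` and `2 ≤ k ≤ 4`, (R̂) holds on the whole cell,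
  Rule Q pays `Φ(q+k, q)` to every member, and the UP-Hall form holds at the tight layer `#E = (q+k) + q` of every finite matroid.
* **`sum_slices_le_rhat`** — for EVERY `k` and every `m ≤ q`: `Σ_{1 ≤ j < k} C(q+k−m, j)·S_j ≤ R̂(q, k, m)` with the slice sums
  `S_j = Σ_{a ≤ m} C(m, a)/C(q+j+a, a+j)` (from `mhat_le_choose`: the truncation in `m̂` only drops terms) — the general form of
  CellFourRow's `rhat_four_ge`, so that a future cell family `k` only needs lower bounds on its slice sums.
Axioms: standard.
-/

namespace PercRepro

open Finset

/-- **(R̂) on every cell `(q+k, q)` with `2 ≤ k ≤ 4`**, every `q ≥ 1`. -/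
theorem rhatCell_of_le_four (q k : ℕ) (hq : 1 ≤ q) (hk : 2 ≤ k) (hk4 : k ≤ 4) : RhatCell q k := by
  interval_cases k
  · exact rhatCell_two q hq
  · exact rhatCell_three q hq
  · exact rhatCell_four q hq

variable {α : Type} (M : Matroid α) [M.Finite]

/-- **Rule Q pays `Φ(q+k, q)` to every member of every cell `(q+k, q)` with `2 ≤ k ≤ 4`** at the tight layer of every finite
matroid, every `q ≥ 1`. -/
theorem ruleQUp_of_le_four (q k : ℕ) (hq : 1 ≤ q) (hk : 2 ≤ k) (hk4 : k ≤ 4) (hE : M.E.ncard = (q + k) + q) :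
    RuleQUp M (q + k) q :=
  ruleQUp_of_ncard_eq_of_rhatCell M (rhatCell_of_le_four q k hq hk hk4) hE

/-- **The UP-Hall form of C-044 on every cell `(q+k, q)` with `2 ≤ k ≤ 4`** at the tight layer of every finite matroid,
every `q ≥ 1`. -/
theorem hallUp_of_le_four (q k : ℕ) (hq : 1 ≤ q) (hk : 2 ≤ k) (hk4 : k ≤ 4) (hE : M.E.ncard = (q + k) + q)
    (𝒜 : Set (Set α)) (h𝒜 : 𝒜 ⊆ cellMembers M (q + k) q) :
    phiK (q + k) q * (𝒜.ncard : ℚ) ≤ ((upNbhd M (q + k) q 𝒜).ncard : ℚ) :=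
  hallUp_of_ncard_eq_of_rhatCell M (rhatCell_of_le_four q k hq hk hk4) hE 𝒜 h𝒜

/-- **The slice sums below `R̂` for every `k`** (`q = m + u`): `Σ_{j < k−1} C(u+k, j+1)·S_{j+1} ≤ R̂(q, k, m)`,
`S_j = Σ_{a ≤ m} C(m, a)/C(q+j+a, a+j)`. -/
theorem sum_slices_le_rhat (m u k : ℕ) :
    ∑ j ∈ range (k - 1), ((u + k).choose (j + 1) : ℚ)
        * ∑ a ∈ range (m + 1), (m.choose a : ℚ) / ((m + u + (j + 1) + a).choose (a + (j + 1)) : ℚ)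
      ≤ rhat (m + u) k m := by
  unfold rhat
  rw [sum_Ioo_nat, show k - (0 + 1) = k - 1 by omega, show m + u + k - m = u + k by omega]
  refine Finset.sum_le_sum (fun j _ => ?_)
  rw [Finset.mul_sum]
  refine Finset.sum_le_sum (fun a _ => ?_)
  have hpos : (0 : ℚ) < mhat (m + u) m a (0 + 1 + j) := by exact_mod_cast mhat_pos _ _ _ _
  have hle : (mhat (m + u) m a (0 + 1 + j) : ℚ) ≤ ((m + u + (j + 1) + a).choose (a + (j + 1)) : ℚ) := by
    have h := mhat_le_choose (m + u) m a (j + 1)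
    rw [show 0 + 1 + j = j + 1 by ring]
    exact_mod_cast h
  rw [show 0 + 1 + j = j + 1 by ring] at hpos hle ⊢
  push_cast
  rw [show ((u + k).choose (j + 1) : ℚ) * ((m.choose a : ℚ) / ((m + u + (j + 1) + a).choose (a + (j + 1)) : ℚ))
    = (m.choose a : ℚ) * ((u + k).choose (j + 1) : ℚ) / ((m + u + (j + 1) + a).choose (a + (j + 1)) : ℚ) by ring]
  exact div_le_div_of_nonneg_left (by positivity) hpos hle

end PercRepro
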